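import Mathlib.Analysis.SpecialFunctions.Pow.Real
import Mathlib.Analysis.SpecialFunctions.Log.Basic
import Mathlib.Analysis.SpecialFunctions.Exp
import Mathlib.Analysis.Complex.Exponential
import Mathlib.Analysis.Complex.ExponentialBounds
import Mathlib.Analysis.MeanInequalities
import HarnessLib

/-!
# Elementary inequalities for BD18 §3.3 (Lemma 3.3 and Proposition 3.1)

Topic `Literature/Analysis/Fourier`. Real-variable lemmas used in the formalisation of
J. Bourgain, S. Dyatlov, *Spectral gaps without the pressure condition*, Ann. of Math. 187 (2018),
§3.3, about the function `θ(ξ) = log(10 + |ξ|)^{-(1+δ)/2}` of BD18 (3.1) (here with a general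
exponent `-p`, `0 ≤ p ≤ 1`), the lattice sums `∑_ℓ (1 + (ζ+ℓ)²)⁻¹`, a Young-type splitting
`P^κ Q^{1-κ} ≤ s P + s^{-κ/(1-κ)} Q`, and the final choice of the frequency threshold `K`
("fixing `K` large enough depending only on `δ, C_R, c₁`", end of the proof of Proposition 3.1).
All statements are folklore / bookkeeping; no definitions are introduced.
-/

namespace Literature.Analysis.Fourier.Prop31

open Real Finset

/-- `2 ≤ log 10`. [folklore] -/
theorem two_le_log_ten : (2 : ℝ) ≤ Real.log 10 := by
  rw [Real.le_log_iff_exp_le (by norm_num)]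
  have h := Real.exp_one_lt_d9
  have : Real.exp 2 = Real.exp 1 * Real.exp 1 := by rw [← Real.exp_add]; norm_num
  rw [this]
  nlinarith [Real.exp_pos 1]

/-- `1 ≤ log (10 + y)` for `y ≥ 0`. [folklore] -/
theorem one_le_log_ten_add {y : ℝ} (hy : 0 ≤ y) : (1 : ℝ) ≤ Real.log (10 + y) := by
  have h1 : Real.log 10 ≤ Real.log (10 + y) := Real.log_le_log (by norm_num) (by linarith)
  linarith [two_le_log_ten]

/-- `θ(y) = log(10+y)^{-p} > 0`. [cite: BourgainDyatlov2018, (3.1)] -/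
theorem theta_pos (p : ℝ) {y : ℝ} (hy : 0 ≤ y) : 0 < Real.log (10 + y) ^ (-p) :=
  Real.rpow_pos_of_pos (by linarith [one_le_log_ten_add hy]) _

/-- `θ(y) ≤ 1` for `p ≥ 0`, `y ≥ 0`. [cite: BourgainDyatlov2018, (3.1)] -/
theorem theta_le_one {p y : ℝ} (hp : 0 ≤ p) (hy : 0 ≤ y) : Real.log (10 + y) ^ (-p) ≤ 1 :=
  Real.rpow_le_one_of_one_le_of_nonpos (one_le_log_ten_add hy) (by linarith)

/-- `θ` is decreasing on `[0, ∞)`: `y ≤ K ⇒ θ(K) ≤ θ(y)` ("since `θ(ξ)` is decreasing for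
`ξ ≥ 0`", proof of Lemma 3.3). [cite: BourgainDyatlov2018, proof of Lemma 3.3] -/
theorem theta_antitone {p y K : ℝ} (hp : 0 ≤ p) (hy : 0 ≤ y) (hyK : y ≤ K) :
    Real.log (10 + K) ^ (-p) ≤ Real.log (10 + y) ^ (-p) :=
  Real.rpow_le_rpow_of_nonpos (by linarith [one_le_log_ten_add hy])
    (Real.log_le_log (by linarith) (by linarith)) (by linarith)

/-- `log t ≤ 2 (√t - 1)` for `t > 0`. [folklore] -/
theorem log_le_two_mul_sqrt_sub_one {t : ℝ} (ht : 0 < t) : Real.log t ≤ 2 * (Real.sqrt t - 1) := by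
  have hs : 0 < Real.sqrt t := Real.sqrt_pos.2 ht
  have h1 : Real.log t = 2 * Real.log (Real.sqrt t) := by
    conv_lhs => rw [← Real.sq_sqrt ht.le]
    rw [Real.log_pow]
    norm_num
  rw [h1]
  linarith [Real.log_le_sub_one_of_pos hs]

/-- **Growth of `θ(x) x`**: for `1 ≤ K ≤ x`, `θ(K) √K √x ≤ 2 θ(x) x` (so `x ↦ θ(x)x` grows at
least like `√x`; used for the high-frequency tail in the proof of Lemma 3.3).
[cite: BourgainDyatlov2018, proof of Lemma 3.3] -/
theorem theta_mul_growth {p K x : ℝ} (hp1 : p ≤ 1) (hK : 1 ≤ K) (hx : K ≤ x) :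
    Real.log (10 + K) ^ (-p) * Real.sqrt K * Real.sqrt x ≤ 2 * (Real.log (10 + x) ^ (-p) * x) := by
  set a : ℝ := Real.log (10 + K) with ha
  set b : ℝ := Real.log (10 + x) with hb
  have ha2 : 2 ≤ a := by
    have := Real.log_le_log (by norm_num) (show (10 : ℝ) ≤ 10 + K by linarith)
    linarith [two_le_log_ten]
  have hab : a ≤ b := Real.log_le_log (by linarith) (by linarith)
  have ha0 : 0 < a := by linarith
  have hb0 : 0 < b := by linarith
  have hx0 : 0 < x := by linarith
  have hK0 : 0 < K := by linarith
  set t : ℝ := x / K with ht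
  have ht1 : 1 ≤ t := by rw [ht, le_div_iff₀ hK0]; linarith
  have ht0 : 0 < t := by linarith
  -- `b ≤ a + log t`
  have hbt : b ≤ a + Real.log t := by
    rw [hb, ha, ht, ← Real.log_mul (by linarith) (by positivity)]
    apply Real.log_le_log (by linarith)
    rw [mul_div_assoc', le_div_iff₀ hK0]
    nlinarith
  -- `log t ≤ 2(√t - 1)` hence `b ≤ 2 a √t`
  have hst : 1 ≤ Real.sqrt t := by rw [Real.le_sqrt (by norm_num) ht0.le]; simpa using ht1
  have hb2 : b ≤ 2 * a * Real.sqrt t := by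
    have := log_le_two_mul_sqrt_sub_one ht0
    nlinarith
  -- `√x = √K √t`
  have hsx : Real.sqrt x = Real.sqrt K * Real.sqrt t := by
    rw [← Real.sqrt_mul hK0.le, ht, mul_div_cancel₀ _ hK0.ne']
  have hsK : 0 < Real.sqrt K := Real.sqrt_pos.2 hK0
  have hsKK : Real.sqrt K * Real.sqrt K = K := Real.mul_self_sqrt hK0.le
  have hstt : Real.sqrt t * Real.sqrt t = t := Real.mul_self_sqrt ht0.le
  -- rpow algebra: `b^{-p} ≥ a^{-p} (a/b)` since `(b/a)^p ≤ b/a`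
  have hba1 : 1 ≤ b / a := by rw [le_div_iff₀ ha0]; linarith
  have hbap : (b / a) ^ p ≤ b / a := by
    conv_rhs => rw [← Real.rpow_one (b / a)]
    exact Real.rpow_le_rpow_of_exponent_le hba1 hp1
  have hbp : b ^ (-p) = a ^ (-p) * ((b / a) ^ p)⁻¹ := by
    rw [Real.div_rpow hb0.le ha0.le, inv_div, Real.rpow_neg hb0.le, Real.rpow_neg ha0.le]
    field_simp
  have hap : 0 < a ^ (-p) := Real.rpow_pos_of_pos ha0 _
  have hbapos : 0 < (b / a) ^ p := Real.rpow_pos_of_pos (by positivity) _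
  rw [hbp]
  -- goal: a^{-p} √K √x ≤ 2 (a^{-p} ((b/a)^p)⁻¹ x)
  have key : Real.sqrt K * Real.sqrt x * (b / a) ^ p ≤ 2 * x := by
    calc Real.sqrt K * Real.sqrt x * (b / a) ^ p ≤ Real.sqrt K * Real.sqrt x * (b / a) := by
          apply mul_le_mul_of_nonneg_left hbap; positivity
      _ = Real.sqrt K * Real.sqrt K * Real.sqrt t * b / a := by rw [hsx]; ring
      _ = K * Real.sqrt t * b / a := by rw [hsKK]
      _ ≤ K * Real.sqrt t * (2 * a * Real.sqrt t) / a := by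
          apply div_le_div_of_nonneg_right _ ha0.le
          apply mul_le_mul_of_nonneg_left hb2; positivity
      _ = 2 * (K * (Real.sqrt t * Real.sqrt t)) := by field_simp
      _ = 2 * x := by rw [hstt, ht, mul_div_cancel₀ _ hK0.ne']
  calc a ^ (-p) * Real.sqrt K * Real.sqrt x
      = a ^ (-p) * ((b / a) ^ p)⁻¹ * (Real.sqrt K * Real.sqrt x * (b / a) ^ p) := by
        field_simp
    _ ≤ a ^ (-p) * ((b / a) ^ p)⁻¹ * (2 * x) := by
        apply mul_le_mul_of_nonneg_left key; positivity
    _ = 2 * (a ^ (-p) * ((b / a) ^ p)⁻¹ * x) := by ring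

/-- `log (1 + x²) ≤ 4 √x` for `x ≥ 1`. [folklore] -/
theorem log_one_add_sq_le {x : ℝ} (hx : 1 ≤ x) : Real.log (1 + x ^ 2) ≤ 4 * Real.sqrt x := by
  have hx0 : 0 < x := by linarith
  have h1 : Real.log (1 + x ^ 2) ≤ Real.log (2 * x ^ 2) :=
    Real.log_le_log (by positivity) (by nlinarith)
  have h2 : Real.log (2 * x ^ 2) = Real.log 2 + 2 * Real.log x := by
    rw [Real.log_mul (by norm_num) (by positivity), Real.log_pow]; push_cast; ring
  have h3 := log_le_two_mul_sqrt_sub_one hx0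
  have h4 := Real.log_two_lt_d9
  have h5 : 1 ≤ Real.sqrt x := by rw [Real.le_sqrt (by norm_num) hx0.le]; simpa using hx
  linarith

/-- **High-frequency tail.** If `8 ≤ c θ(K) √K` (`c > 0`, `K ≥ 1`) then for all `x ≥ K`,
`e^{-2cθ(x)x} (1 + x²) ≤ e^{-cθ(K)K/2}` (BD18 (3.17): "`‖g₂‖ ≤ C exp(-C⁻¹θ(K)K) ‖f‖_{H^{-10}}`",
here with the weight `⟨ξ⟩^{-2}` in place of `⟨ξ⟩^{-20}`). [cite: BourgainDyatlov2018, (3.17)] -/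
theorem tail_bound {c p K : ℝ} (hc : 0 < c) (hp1 : p ≤ 1) (hK : 1 ≤ K)
    (h8 : 8 ≤ c * Real.log (10 + K) ^ (-p) * Real.sqrt K) {x : ℝ} (hx : K ≤ x) :
    Real.exp (-(2 * c * Real.log (10 + x) ^ (-p) * x)) * (1 + x ^ 2) ≤
      Real.exp (-(c * Real.log (10 + K) ^ (-p) * K / 2)) := by
  have hx1 : 1 ≤ x := hK.trans hx
  have hx0 : 0 < x := by linarith
  have hK0 : 0 < K := by linarith
  have hg := theta_mul_growth hp1 hK hx
  set θK := Real.log (10 + K) ^ (-p) with hθK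
  set θx := Real.log (10 + x) ^ (-p) with hθx
  have hθK0 : 0 < θK := theta_pos p hK0.le
  have hsK : Real.sqrt K ≤ Real.sqrt x := Real.sqrt_le_sqrt hx
  have hsKK : Real.sqrt K * Real.sqrt K = K := Real.mul_self_sqrt hK0.le
  have hsx0 : 0 ≤ Real.sqrt x := Real.sqrt_nonneg _
  have hsK0 : 0 ≤ Real.sqrt K := Real.sqrt_nonneg _
  -- `2 c θx x ≥ c θK √K √x ≥ c θK K / 2 + 4 √x ≥ c θK K/2 + log(1+x²)`
  have h1 : c * θK * K / 2 + 4 * Real.sqrt x ≤ 2 * c * θx * x := by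
    have hA : c * θK * Real.sqrt K * Real.sqrt x ≤ 2 * c * θx * x := by nlinarith
    have hB : c * θK * K ≤ c * θK * Real.sqrt K * Real.sqrt x := by
      have : c * θK * (Real.sqrt K * Real.sqrt K) ≤ c * θK * (Real.sqrt K * Real.sqrt x) := by
        apply mul_le_mul_of_nonneg_left _ (by positivity)
        exact mul_le_mul_of_nonneg_left hsK hsK0
      calc c * θK * K = c * θK * (Real.sqrt K * Real.sqrt K) := by rw [hsKK]
        _ ≤ c * θK * (Real.sqrt K * Real.sqrt x) := this
        _ = c * θK * Real.sqrt K * Real.sqrt x := by ring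
    have hC : 8 * Real.sqrt x ≤ c * θK * Real.sqrt K * Real.sqrt x :=
      mul_le_mul_of_nonneg_right h8 hsx0
    nlinarith
  have h2 := log_one_add_sq_le hx1
  have h3 : -(2 * c * θx * x) ≤ -(c * θK * K / 2) - Real.log (1 + x ^ 2) := by linarith
  calc Real.exp (-(2 * c * θx * x)) * (1 + x ^ 2)
      ≤ Real.exp (-(c * θK * K / 2) - Real.log (1 + x ^ 2)) * (1 + x ^ 2) := by
        apply mul_le_mul_of_nonneg_right (Real.exp_le_exp.2 h3); positivity
    _ = Real.exp (-(c * θK * K / 2)) := by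
        rw [Real.exp_sub, Real.exp_log (by positivity)]
        field_simp

/-- **Peetre-type shift**: `(1 + ξ²)⁻¹ ≤ 9 (1 + (ξ - η)²)⁻¹` for `|η| ≤ 2`. [folklore] -/
theorem inv_one_add_sq_le_shift {η : ℝ} (hη : |η| ≤ 2) (ξ : ℝ) :
    (1 + ξ ^ 2)⁻¹ ≤ 9 * (1 + (ξ - η) ^ 2)⁻¹ := by
  rw [abs_le] at hη
  have h : 1 + (ξ - η) ^ 2 ≤ 9 * (1 + ξ ^ 2) := by nlinarith [sq_nonneg (ξ + η), sq_nonneg η]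
  rw [← div_eq_mul_inv, le_div_iff₀ (by positivity)]
  calc (1 + ξ ^ 2)⁻¹ * (1 + (ξ - η) ^ 2) ≤ (1 + ξ ^ 2)⁻¹ * (9 * (1 + ξ ^ 2)) := by
        apply mul_le_mul_of_nonneg_left h; positivity
    _ = 9 := by field_simp

/-- `e^{-2c⟨ξ⟩^{1/2}} ≤ (3/2) c⁻⁴ ⟨ξ⟩⁻²`, i.e. the decay (3.4) of the multiplier dominates the
weight `(1 + ξ²)⁻¹`. [folklore] -/
theorem exp_neg_japanese_le {c : ℝ} (hc : 0 < c) (ξ : ℝ) :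
    Real.exp (-(2 * c * (1 + ξ ^ 2) ^ ((1 : ℝ) / 4))) ≤ 3 / 2 * c⁻¹ ^ 4 * (1 + ξ ^ 2)⁻¹ := by
  set v : ℝ := (1 + ξ ^ 2) ^ ((1 : ℝ) / 4) with hv
  have hv0 : 0 < v := Real.rpow_pos_of_pos (by positivity) _
  have hv4 : v ^ 4 = 1 + ξ ^ 2 := by
    rw [hv, ← Real.rpow_natCast, ← Real.rpow_mul (by positivity)]
    norm_num
  have hy : 0 ≤ 2 * c * v := by positivity
  have h1 := Real.pow_div_factorial_le_exp (2 * c * v) hy 4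
  have h24 : ((4 : ℕ).factorial : ℝ) = 24 := by norm_num [Nat.factorial]
  rw [h24] at h1
  -- `(2cv)^4/24 ≤ e^{2cv}` ⇒ `e^{-2cv} ≤ 24/(2cv)^4 = (3/2) c⁻⁴ v⁻⁴`
  have hpos : 0 < (2 * c * v) ^ 4 / 24 := by positivity
  rw [Real.exp_neg, ← hv4]
  calc (Real.exp (2 * c * v))⁻¹ ≤ ((2 * c * v) ^ 4 / 24)⁻¹ := inv_anti₀ hpos h1
    _ = 3 / 2 * c⁻¹ ^ 4 * (v ^ 4)⁻¹ := by field_simp; ring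

/-- `∑_{|n| ≤ N} (1 + n²)⁻¹ ≤ 5 - 4/(2N+1)` (telescoping). [folklore] -/
theorem sum_Icc_inv_one_add_sq_le (N : ℕ) :
    ∑ n ∈ Finset.Icc (-(N : ℤ)) N, (1 + (n : ℝ) ^ 2)⁻¹ ≤ (5 : ℝ) - 4 / (2 * (N : ℝ) + 1) := by
  induction N with
  | zero => simp; norm_num
  | succ N ih =>
    have hset : Finset.Icc (-((N + 1 : ℕ) : ℤ)) ((N + 1 : ℕ) : ℤ) =
        insert (-((N : ℤ) + 1)) (insert ((N : ℤ) + 1) (Finset.Icc (-(N : ℤ)) N)) := by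
      ext x
      simp only [Finset.mem_Icc, Finset.mem_insert]
      push_cast
      omega
    have h1 : (-((N : ℤ) + 1)) ∉ insert ((N : ℤ) + 1) (Finset.Icc (-(N : ℤ)) N) := by
      simp only [Finset.mem_insert, Finset.mem_Icc]; omega
    have h2 : ((N : ℤ) + 1) ∉ Finset.Icc (-(N : ℤ)) N := by
      simp only [Finset.mem_Icc]; omega
    rw [hset, Finset.sum_insert h1, Finset.sum_insert h2]
    have hstep : (1 + ((N : ℝ) + 1) ^ 2)⁻¹ ≤ (4 : ℝ) / ((2 * (N : ℝ) + 1) * (2 * (N : ℝ) + 3)) := by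
      rw [inv_eq_one_div, div_le_div_iff₀ (by positivity) (by positivity)]
      nlinarith
    have htel : 2 * ((4 : ℝ) / ((2 * (N : ℝ) + 1) * (2 * (N : ℝ) + 3))) =
        4 / (2 * (N : ℝ) + 1) - 4 / (2 * ((N : ℝ) + 1) + 1) := by
      field_simp; ring
    have hc1 : (((-((N : ℤ) + 1) : ℤ)) : ℝ) = -((N : ℝ) + 1) := by push_cast; ring
    have hc2 : ((((N : ℤ) + 1 : ℤ)) : ℝ) = (N : ℝ) + 1 := by push_cast; ring
    have hc3 : (((N + 1 : ℕ)) : ℝ) = (N : ℝ) + 1 := by push_cast; ring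
    rw [hc1, hc2, hc3, neg_sq]
    linarith

/-- `∑_{n ∈ S} (1 + n²)⁻¹ ≤ 5` for every finite `S ⊂ ℤ`. [folklore] -/
theorem sum_inv_one_add_sq_int_le (S : Finset ℤ) : ∑ n ∈ S, (1 + (n : ℝ) ^ 2)⁻¹ ≤ 5 := by
  set N : ℕ := S.sup fun n => n.natAbs with hN
  have hsub : S ⊆ Finset.Icc (-(N : ℤ)) N := by
    intro n hn
    have : n.natAbs ≤ N := Finset.le_sup (f := fun n : ℤ => n.natAbs) hn
    simp only [Finset.mem_Icc]
    omega
  calc ∑ n ∈ S, (1 + (n : ℝ) ^ 2)⁻¹ ≤ ∑ n ∈ Finset.Icc (-(N : ℤ)) N, (1 + (n : ℝ) ^ 2)⁻¹ :=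
        Finset.sum_le_sum_of_subset_of_nonneg hsub fun _ _ _ => by positivity
    _ ≤ (5 : ℝ) - 4 / (2 * (N : ℝ) + 1) := sum_Icc_inv_one_add_sq_le N
    _ ≤ 5 := by
        have : (0 : ℝ) ≤ 4 / (2 * (N : ℝ) + 1) := by positivity
        linarith

/-- **Lattice sums of the weight `⟨·⟩⁻²`**: `∑_{ℓ ∈ Λ} (1 + (ζ + ℓ)²)⁻¹ ≤ 20` uniformly in
`ζ ∈ ℝ` and finite `Λ ⊂ ℤ` (this is what makes the constants in (3.19) independent of `α₁`).
[cite: BourgainDyatlov2018, (3.19)] -/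
theorem sum_inv_one_add_sq_le (Λ : Finset ℤ) (ζ : ℝ) :
    ∑ ℓ ∈ Λ, (1 + (ζ + (ℓ : ℝ)) ^ 2)⁻¹ ≤ 20 := by
  set c : ℤ := ⌊ζ⌋ with hc
  have hfr0 : 0 ≤ ζ - c := by rw [hc]; exact Int.fract_nonneg ζ
  have hfr1 : ζ - c < 1 := by rw [hc]; exact Int.fract_lt_one ζ
  have hterm : ∀ ℓ : ℤ, (1 + (ζ + (ℓ : ℝ)) ^ 2)⁻¹ ≤ 4 * (1 + (((ℓ + c : ℤ)) : ℝ) ^ 2)⁻¹ := by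
    intro ℓ
    set n : ℤ := ℓ + c with hn
    have hζ : ζ + ℓ = n + (ζ - c) := by rw [hn]; push_cast; ring
    rw [hζ]
    set s : ℝ := ζ - c
    have key : 1 + (n : ℝ) ^ 2 ≤ 4 * (1 + ((n : ℝ) + s) ^ 2) := by
      rcases le_or_gt 0 n with h | h
      · have : (0 : ℝ) ≤ n := by exact_mod_cast h
        nlinarith
      · have hn1 : (n : ℝ) ≤ -1 := by exact_mod_cast (show n ≤ -1 by omega)
        have hle : (n : ℝ) + s ≤ 0 := by linarith
        have hsq : ((n : ℝ) + 1) ^ 2 ≤ ((n : ℝ) + s) ^ 2 := by nlinarith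
        nlinarith [sq_nonneg ((n : ℝ) + 4 / 3)]
    rw [← div_eq_mul_inv, le_div_iff₀ (by positivity)]
    calc (1 + ((n : ℝ) + s) ^ 2)⁻¹ * (1 + (n : ℝ) ^ 2)
        ≤ (1 + ((n : ℝ) + s) ^ 2)⁻¹ * (4 * (1 + ((n : ℝ) + s) ^ 2)) :=
          mul_le_mul_of_nonneg_left key (by positivity)
      _ = 4 := by field_simp
  calc ∑ ℓ ∈ Λ, (1 + (ζ + (ℓ : ℝ)) ^ 2)⁻¹ ≤ ∑ ℓ ∈ Λ, 4 * (1 + (((ℓ + c : ℤ)) : ℝ) ^ 2)⁻¹ :=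
        Finset.sum_le_sum fun ℓ _ => hterm ℓ
    _ = 4 * ∑ n ∈ Λ.map (Equiv.addRight c).toEmbedding, (1 + (n : ℝ) ^ 2)⁻¹ := by
        rw [Finset.mul_sum, Finset.sum_map]
        rfl
    _ ≤ 4 * 5 := by
        apply mul_le_mul_of_nonneg_left (sum_inv_one_add_sq_int_le _) (by norm_num)
    _ = 20 := by norm_num

/-- **Young-type splitting**: `P^κ Q^{1-κ} ≤ s P + s^{-κ/(1-κ)} Q` for `0 < κ < 1`, `P, Q ≥ 0`,
`s > 0` (used in place of Hölder's inequality (2.6) of BD18 to sum the interpolation bounds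
over the frequency windows). [folklore] -/
theorem rpow_mul_rpow_le {κ P Q s : ℝ} (hκ0 : 0 < κ) (hκ1 : κ < 1) (hP : 0 ≤ P) (hQ : 0 ≤ Q)
    (hs : 0 < s) : P ^ κ * Q ^ (1 - κ) ≤ s * P + s ^ (-(κ / (1 - κ))) * Q := by
  have h1κ : 0 < 1 - κ := by linarith
  set a : ℝ := s / κ with ha
  have ha0 : 0 < a := by positivity
  set b : ℝ := a ^ (-(κ / (1 - κ))) with hb
  have hb0 : 0 < b := Real.rpow_pos_of_pos ha0 _
  -- weighted AM–GM for `aP`, `bQ`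
  have hyoung := Real.geom_mean_le_arith_mean2_weighted hκ0.le h1κ.le (mul_nonneg ha0.le hP)
    (mul_nonneg hb0.le hQ) (by ring)
  have hab : a ^ κ * b ^ (1 - κ) = 1 := by
    rw [hb, ← Real.rpow_mul ha0.le, show -(κ / (1 - κ)) * (1 - κ) = -κ by field_simp,
      ← Real.rpow_add ha0]
    simp
  have hlhs : (a * P) ^ κ * (b * Q) ^ (1 - κ) = P ^ κ * Q ^ (1 - κ) := by
    rw [Real.mul_rpow ha0.le hP, Real.mul_rpow hb0.le hQ]
    calc a ^ κ * P ^ κ * (b ^ (1 - κ) * Q ^ (1 - κ))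
        = (a ^ κ * b ^ (1 - κ)) * (P ^ κ * Q ^ (1 - κ)) := by ring
      _ = P ^ κ * Q ^ (1 - κ) := by rw [hab, one_mul]
  rw [hlhs] at hyoung
  -- `κ a = s` and `(1-κ) b ≤ s^{-κ/(1-κ)}`
  have h1 : κ * (a * P) = s * P := by rw [ha]; field_simp
  have h2 : (1 - κ) * (b * Q) ≤ s ^ (-(κ / (1 - κ))) * Q := by
    have hbs : b ≤ s ^ (-(κ / (1 - κ))) := by
      rw [hb, ha, Real.div_rpow hs.le hκ0.le, Real.rpow_neg hκ0.le]
      rw [div_eq_mul_inv, inv_inv]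
      have hκe : κ ^ (κ / (1 - κ)) ≤ 1 := Real.rpow_le_one hκ0.le hκ1.le (by positivity)
      have hs0 : 0 ≤ s ^ (-(κ / (1 - κ))) := (Real.rpow_pos_of_pos hs _).le
      nlinarith
    have : (1 - κ) * (b * Q) ≤ 1 * (b * Q) :=
      mul_le_mul_of_nonneg_right (by linarith) (mul_nonneg hb0.le hQ)
    nlinarith [mul_le_mul_of_nonneg_right hbs hQ]
  linarith


/-- `exp 4 ≥ 53`. [folklore] -/
theorem exp_four_ge : (53 : ℝ) ≤ Real.exp 4 := by
  have h := Real.exp_one_gt_d9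
  have h4 : Real.exp 4 = Real.exp 1 ^ 4 := by rw [← Real.exp_nat_mul]; norm_num
  rw [h4]
  have h27 : (2.7 : ℝ) ≤ Real.exp 1 := by linarith
  calc (53 : ℝ) ≤ 2.7 ^ 4 := by norm_num
    _ ≤ Real.exp 1 ^ 4 := pow_le_pow_left₀ (by norm_num) h27 4

/-- Growth bookkeeping for the choice of `K`: `(D + 3u) e^{u/4} + 8Du ≤ c e^u/(4u)` once
`u ≥ 4800 D/c²` (`0 < c ≤ 1 ≤ D`, `u ≥ 4`). [folklore] -/
theorem key_growth {c D u : ℝ} (hc0 : 0 < c) (hc1 : c ≤ 1) (hD1 : 1 ≤ D) (hu4 : 4 ≤ u)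
    (huD : 4800 * D / c ^ 2 ≤ u) :
    (D + 3 * u) * Real.exp (u / 4) + 8 * D * u ≤ c * Real.exp u / (4 * u) := by
  have hu0 : 0 < u := by linarith
  have hu1 : 1 ≤ u := by linarith
  have hD0 : 0 < D := by linarith
  have hc2 : 0 < c ^ 2 := by positivity
  -- `e^{3u/4} ≥ u⁴/76`
  have h76 : u ^ 4 / 76 ≤ Real.exp (3 * u / 4) := by
    have h := Real.pow_div_factorial_le_exp (3 * u / 4) (by positivity) 4
    have h24 : ((Nat.factorial 4 : ℕ) : ℝ) = 24 := by norm_num [Nat.factorial]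
    rw [h24] at h
    refine le_trans ?_ h
    rw [div_pow, div_div, div_le_div_iff₀ (by norm_num) (by norm_num)]
    have : (0 : ℝ) ≤ u ^ 4 := by positivity
    nlinarith
  -- `c u ≥ 3952 D`
  have hcu1 : 3952 * D ≤ c * u := by
    have h2 : c * (4800 * D / c ^ 2) ≤ c * u := mul_le_mul_of_nonneg_left huD hc0.le
    have h3 : c * (4800 * D / c ^ 2) = 4800 * D / c := by field_simp
    have h4 : 4800 * D ≤ 4800 * D / c := by
      rw [le_div_iff₀ hc0]; nlinarith
    linarith
  -- `52 D u² ≤ c e^{3u/4}`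
  have hce : 52 * D * u ^ 2 ≤ c * Real.exp (3 * u / 4) := by
    have h1 : 52 * D * u ^ 2 ≤ c * (u ^ 4 / 76) := by
      have h2 : c * (u ^ 4 / 76) = (c * u) * u ^ 3 / 76 := by ring
      have h3 : 3952 * D * u ^ 3 / 76 ≤ (c * u) * u ^ 3 / 76 := by
        apply div_le_div_of_nonneg_right _ (by norm_num)
        exact mul_le_mul_of_nonneg_right hcu1 (by positivity)
      have h4 : 3952 * D * u ^ 3 / 76 = 52 * D * u ^ 2 * u := by ring
      have h5 : 52 * D * u ^ 2 * 1 ≤ 52 * D * u ^ 2 * u :=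
        mul_le_mul_of_nonneg_left hu1 (by positivity)
      linarith
    exact h1.trans (mul_le_mul_of_nonneg_left h76 hc0.le)
  -- `4u((D+3u)e^{u/4} + 8Du) ≤ 52 D u² e^{u/4}`
  have he4 : 1 ≤ Real.exp (u / 4) := Real.one_le_exp (by positivity)
  have he0 : 0 < Real.exp (u / 4) := Real.exp_pos _
  have hsum : 4 * u * ((D + 3 * u) * Real.exp (u / 4) + 8 * D * u) ≤
      52 * D * u ^ 2 * Real.exp (u / 4) := by
    have h1 : 32 * D * u ^ 2 ≤ 32 * D * u ^ 2 * Real.exp (u / 4) := by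
      have : 32 * D * u ^ 2 * 1 ≤ 32 * D * u ^ 2 * Real.exp (u / 4) :=
        mul_le_mul_of_nonneg_left he4 (by positivity)
      linarith
    have h2 : 4 * u * D ≤ 4 * D * u ^ 2 := by nlinarith
    have h3 : 12 * u ^ 2 ≤ 12 * D * u ^ 2 := by nlinarith
    have h4 : (4 * u * D + 12 * u ^ 2) * Real.exp (u / 4) ≤ (16 * D * u ^ 2) * Real.exp (u / 4) :=
      mul_le_mul_of_nonneg_right (by linarith) he0.le
    calc 4 * u * ((D + 3 * u) * Real.exp (u / 4) + 8 * D * u)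
        = (4 * u * D + 12 * u ^ 2) * Real.exp (u / 4) + 32 * D * u ^ 2 := by ring
      _ ≤ 16 * D * u ^ 2 * Real.exp (u / 4) + 32 * D * u ^ 2 * Real.exp (u / 4) := add_le_add h4 h1
      _ = 48 * D * u ^ 2 * Real.exp (u / 4) := by ring
      _ ≤ 52 * D * u ^ 2 * Real.exp (u / 4) := by
          apply mul_le_mul_of_nonneg_right _ he0.le; nlinarith
  have hexp : Real.exp u = Real.exp (3 * u / 4) * Real.exp (u / 4) := by
    rw [← Real.exp_add]; congr 1; ring
  rw [le_div_iff₀ (by positivity), hexp]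
  calc ((D + 3 * u) * Real.exp (u / 4) + 8 * D * u) * (4 * u)
      = 4 * u * ((D + 3 * u) * Real.exp (u / 4) + 8 * D * u) := by ring
    _ ≤ 52 * D * u ^ 2 * Real.exp (u / 4) := hsum
    _ ≤ c * Real.exp (3 * u / 4) * Real.exp (u / 4) := mul_le_mul_of_nonneg_right hce he0.le
    _ = c * (Real.exp (3 * u / 4) * Real.exp (u / 4)) := by ring

/-- `log (D (1+K²) u^p) ≤ D + 3u` for `K ≤ e^u`, `u^p ≤ u`, `D, u ≥ 1`. [folklore] -/
theorem log_gamma_le {D K u q : ℝ} (hD1 : 1 ≤ D) (hu1 : 1 ≤ u) (hK0 : 0 ≤ K)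
    (hKe : K ≤ Real.exp u) (hq0 : 0 < q) (hqu : q ≤ u) :
    Real.log (D * (1 + K ^ 2) * q) ≤ D + 3 * u := by
  have hD0 : 0 < D := by linarith
  have hu0 : 0 < u := by linarith
  have hK2e : 1 + K ^ 2 ≤ 2 * Real.exp (2 * u) := by
    have : Real.exp (2 * u) = Real.exp u ^ 2 := by rw [← Real.exp_nat_mul]; norm_num
    rw [this]
    have h1 : (1 : ℝ) ≤ Real.exp u := Real.one_le_exp hu0.le
    nlinarith
  have hle : D * (1 + K ^ 2) * q ≤ D * (2 * Real.exp (2 * u)) * u := by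
    apply mul_le_mul _ hqu hq0.le (by positivity)
    exact mul_le_mul_of_nonneg_left hK2e hD0.le
  calc Real.log (D * (1 + K ^ 2) * q) ≤ Real.log (D * (2 * Real.exp (2 * u)) * u) :=
        Real.log_le_log (by positivity) hle
    _ = Real.log D + Real.log 2 + 2 * u + Real.log u := by
        rw [Real.log_mul (by positivity) hu0.ne', Real.log_mul hD0.ne' (by positivity),
          Real.log_mul (by norm_num) (Real.exp_pos _).ne', Real.log_exp]
        ring
    _ ≤ (D - 1) + 1 + 2 * u + (u - 1) := by
        gcongr
        · exact Real.log_le_sub_one_of_pos hD0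
        · linarith [Real.log_two_lt_d9]
        · exact Real.log_le_sub_one_of_pos hu0
    _ ≤ D + 3 * u := by linarith

/-- Part (i) of the threshold: `8 ≤ c θK √K` from `u⁻¹ ≤ θK`, `u⁴/48 ≤ K`, `19200 ≤ c²u²`.
[folklore] -/
theorem eight_le_of {c θK K u : ℝ} (hc0 : 0 < c) (hu0 : 0 < u) (hθu : u⁻¹ ≤ θK)
    (hK : u ^ 4 / 48 ≤ K) (hcu : 19200 ≤ c ^ 2 * u ^ 2) : 8 ≤ c * θK * Real.sqrt K := by
  have hθ0 : 0 < θK := lt_of_lt_of_le (by positivity) hθu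
  have hK0 : 0 < K := lt_of_lt_of_le (by positivity) hK
  have hX0 : 0 ≤ c * θK * Real.sqrt K := by positivity
  have hsq : (c * θK * Real.sqrt K) ^ 2 = c ^ 2 * θK ^ 2 * K := by
    rw [mul_pow, mul_pow, Real.sq_sqrt hK0.le]
  have hθ2 : u⁻¹ ^ 2 ≤ θK ^ 2 := pow_le_pow_left₀ (by positivity) hθu 2
  have hc2 : 0 < c ^ 2 := by positivity
  have h64 : 64 ≤ (c * θK * Real.sqrt K) ^ 2 := by
    rw [hsq]
    have h1 : c ^ 2 * u⁻¹ ^ 2 * (u ^ 4 / 48) ≤ c ^ 2 * θK ^ 2 * K := by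
      calc c ^ 2 * u⁻¹ ^ 2 * (u ^ 4 / 48) ≤ c ^ 2 * θK ^ 2 * (u ^ 4 / 48) := by
            apply mul_le_mul_of_nonneg_right _ (by positivity)
            exact mul_le_mul_of_nonneg_left hθ2 hc2.le
        _ ≤ c ^ 2 * θK ^ 2 * K := mul_le_mul_of_nonneg_left hK (by positivity)
    have h2 : c ^ 2 * u⁻¹ ^ 2 * (u ^ 4 / 48) = c ^ 2 * u ^ 2 / 48 := by
      field_simp
    rw [h2] at h1
    linarith
  nlinarith

/-- **The choice of `K`** ("fixing `K` large enough depending only on `δ, C_R, c₁`", end of the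
proof of BD18 Proposition 3.1, together with `r = c₂θ(K)/10`, `κ = e^{-C/r}` from the proof of
Lemma 3.3): for `0 < c ≤ 1 ≤ C₀` and `0 < p < 1` there is `K ≥ 10` such that, with
`θK = log(10+K)^{-p}`, `r = cθK/10`, `κ = e^{-C₀/r}`, `E = e^{-cθK K/2}`,
`γ = 14400 C₀ (1+K²)/(c³ θK)` and `s = (4γ)^{(1-κ)/κ}`: `c θK √K ≥ 8` and
`(8/c²)((C₀/r)·360·E·s + 180·E) ≤ 1/4`. The point is that `κ θ(K) K ≫ log K` because `p < 1`
(BD18: "`κK ≥ C⁻¹√K` and thus `lim_{K→∞} K^{21} exp(-C⁻¹θ(K)κK) = 0`"); here `K = e^u - 10` with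
`u` explicit. [cite: BourgainDyatlov2018, end of proof of Proposition 3.1] -/
theorem exists_threshold {c C₀ p : ℝ} (hc0 : 0 < c) (hc1 : c ≤ 1) (hC : 1 ≤ C₀) (hp0 : 0 < p)
    (hp1 : p < 1) :
    ∃ K : ℝ, 10 ≤ K ∧ ∀ θK r κ E γ s : ℝ,
      θK = Real.log (10 + K) ^ (-p) → r = c * θK / 10 → κ = Real.exp (-(C₀ / r)) →
      E = Real.exp (-(c * θK * K / 2)) → γ = 14400 * C₀ * (1 + K ^ 2) / (c ^ 3 * θK) →
      s = (4 * γ) ^ ((1 - κ) / κ) →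
        8 ≤ c * θK * Real.sqrt K ∧ 8 / c ^ 2 * (C₀ / r * 360 * E * s + 180 * E) ≤ 1 / 4 := by
  -- the auxiliary constants `a, D` and the exponent `u`
  set a : ℝ := 10 * C₀ / c with ha
  set D : ℝ := 57600 * C₀ / c ^ 3 with hD
  have hc2 : 0 < c ^ 2 := by positivity
  have hc3 : 0 < c ^ 3 := by positivity
  have ha0 : 0 < a := by positivity
  have hD1 : 1 ≤ D := by
    rw [hD, le_div_iff₀ hc3]
    have : c ^ 3 ≤ 1 := pow_le_one₀ hc0.le hc1
    nlinarith
  have hD0 : 0 < D := by linarith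
  set u : ℝ := max (max 4 ((4 * a) ^ (1 / (1 - p)))) (4800 * D / c ^ 2) with hu
  have hu4 : 4 ≤ u := le_trans (le_max_left _ _) (le_max_left _ _)
  have hua : (4 * a) ^ (1 / (1 - p)) ≤ u := le_trans (le_max_right _ _) (le_max_left _ _)
  have huD : 4800 * D / c ^ 2 ≤ u := le_max_right _ _
  have hu1 : 1 ≤ u := by linarith
  have hu0 : 0 < u := by linarith
  have h1p : 0 < 1 - p := by linarith
  -- `K = e^u - 10`
  set K : ℝ := Real.exp u - 10 with hK
  have heu : 53 ≤ Real.exp u := exp_four_ge.trans (Real.exp_le_exp.2 hu4)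
  have hK10 : 10 ≤ K := by rw [hK]; linarith
  have hK0 : 0 < K := by linarith
  have hK2 : Real.exp u / 2 ≤ K := by rw [hK]; linarith
  have hKe : K ≤ Real.exp u := by rw [hK]; linarith
  have hlog : Real.log (10 + K) = u := by rw [hK, add_sub_cancel, Real.log_exp]
  refine ⟨K, hK10, ?_⟩
  intro θK r κ E γ s hθ hr hκ hE hγ hs
  -- `θK = u^{-p}`, `u⁻¹ ≤ θK`, `θK⁻¹ = u^p ≤ u`
  rw [hlog] at hθ
  have hθpos : 0 < θK := by rw [hθ]; exact Real.rpow_pos_of_pos hu0 _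
  have hθu : u⁻¹ ≤ θK := by
    rw [hθ, ← Real.rpow_neg_one]
    exact Real.rpow_le_rpow_of_exponent_le hu1 (by linarith)
  have hθinv : θK⁻¹ = u ^ p := by rw [hθ, Real.rpow_neg hu0.le, inv_inv]
  have hup1 : 1 ≤ u ^ p := Real.one_le_rpow hu1 hp0.le
  have hup0 : 0 < u ^ p := by positivity
  have hupu : u ^ p ≤ u := by
    conv_rhs => rw [← Real.rpow_one u]
    exact Real.rpow_le_rpow_of_exponent_le hu1 hp1.le
  -- `e^u ≥ u^4/24`
  have hexp4 : u ^ 4 / 24 ≤ Real.exp u := by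
    have h := Real.pow_div_factorial_le_exp u hu0.le 4
    have h24 : ((Nat.factorial 4 : ℕ) : ℝ) = 24 := by norm_num [Nat.factorial]
    rwa [h24] at h
  constructor
  · -- (i)
    refine eight_le_of hc0 hu0 hθu (by linarith) ?_
    have h1 : c ^ 2 * (4800 * D / c ^ 2) ≤ c ^ 2 * u := mul_le_mul_of_nonneg_left huD hc2.le
    have h2 : c ^ 2 * (4800 * D / c ^ 2) = 4800 * D := by field_simp
    rw [h2] at h1
    have h3 : 4800 * D * u ≤ c ^ 2 * u * u := mul_le_mul_of_nonneg_right h1 hu0.le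
    have h4 : (4800 : ℝ) * 1 * 4 ≤ 4800 * D * u :=
      mul_le_mul (mul_le_mul_of_nonneg_left hD1 (by norm_num)) hu4 (by norm_num) (by positivity)
    calc (19200 : ℝ) = 4800 * 1 * 4 := by norm_num
      _ ≤ c ^ 2 * u * u := h4.trans h3
      _ = c ^ 2 * u ^ 2 := by ring
  · -- (ii)
    have hr' : C₀ / r = a * u ^ p := by
      rw [hr, ha, ← hθinv]
      field_simp
    -- `1/κ = exp(a u^p) ≤ exp(u/4)`
    have haup : a * u ^ p ≤ u / 4 := by
      have h4a : 4 * a ≤ u ^ (1 - p) := by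
        have h0 : 0 ≤ (4 * a) ^ (1 / (1 - p)) := (Real.rpow_pos_of_pos (by positivity) _).le
        calc 4 * a = ((4 * a) ^ (1 / (1 - p))) ^ (1 - p) := by
              rw [← Real.rpow_mul (by positivity), one_div, inv_mul_cancel₀ h1p.ne', Real.rpow_one]
          _ ≤ u ^ (1 - p) := Real.rpow_le_rpow h0 hua h1p.le
      have husplit : u ^ p * u ^ (1 - p) = u := by
        rw [← Real.rpow_add hu0]; norm_num
      calc a * u ^ p = u ^ p * (4 * a) / 4 := by ring
        _ ≤ u ^ p * u ^ (1 - p) / 4 := by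
            apply div_le_div_of_nonneg_right _ (by norm_num)
            exact mul_le_mul_of_nonneg_left h4a hup0.le
        _ = u / 4 := by rw [husplit]
    have hκpos : 0 < κ := by rw [hκ]; exact Real.exp_pos _
    have hκinv : κ⁻¹ ≤ Real.exp (u / 4) := by
      rw [hκ, Real.exp_neg, inv_inv, hr']
      exact Real.exp_le_exp.2 haup
    -- `4γ = D (1 + K²) u^p ≥ 1` and `log (4γ) ≤ D + 3u`
    have h4γ : 4 * γ = D * (1 + K ^ 2) * u ^ p := by
      rw [hγ, hD, ← hθinv]
      field_simp
      ring
    have h4γ1 : 1 ≤ 4 * γ := by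
      rw [h4γ]
      have h1 : (1 : ℝ) ≤ 1 + K ^ 2 := by have := sq_nonneg K; linarith
      have h2 : (1 : ℝ) ≤ D * (1 + K ^ 2) := by
        calc (1 : ℝ) = 1 * 1 := by ring
          _ ≤ D * (1 + K ^ 2) := mul_le_mul hD1 h1 zero_le_one hD0.le
      calc (1 : ℝ) = 1 * 1 := by ring
        _ ≤ D * (1 + K ^ 2) * u ^ p := mul_le_mul h2 hup1 zero_le_one (by positivity)
    have hγpos : 0 < 4 * γ := by linarith
    have hlog4γ : Real.log (4 * γ) ≤ D + 3 * u := by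
      rw [h4γ]; exact log_gamma_le hD1 hu1 hK0.le hKe hup0 hupu
    -- `s ≤ exp((D + 3u) e^{u/4})`
    have hs_le : s ≤ Real.exp ((D + 3 * u) * Real.exp (u / 4)) := by
      rw [hs]
      have h1 : (4 * γ) ^ ((1 - κ) / κ) ≤ (4 * γ) ^ κ⁻¹ := by
        apply Real.rpow_le_rpow_of_exponent_le h4γ1
        rw [div_le_iff₀ hκpos, inv_mul_cancel₀ hκpos.ne']
        linarith
      have h2 : (4 * γ) ^ κ⁻¹ = Real.exp (Real.log (4 * γ) * κ⁻¹) := Real.rpow_def_of_pos hγpos _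
      rw [h2] at h1
      refine h1.trans (Real.exp_le_exp.2 ?_)
      calc Real.log (4 * γ) * κ⁻¹ ≤ (D + 3 * u) * κ⁻¹ :=
            mul_le_mul_of_nonneg_right hlog4γ (by positivity)
        _ ≤ (D + 3 * u) * Real.exp (u / 4) := mul_le_mul_of_nonneg_left hκinv (by positivity)
    have hs0 : 0 ≤ s := by rw [hs]; exact (Real.rpow_pos_of_pos hγpos _).le
    -- `E ≤ exp(-c e^u/(4u))`
    have hE_le : E ≤ Real.exp (-(c * Real.exp u / (4 * u))) := by
      rw [hE]
      apply Real.exp_le_exp.2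
      have h1 : c * u⁻¹ * (Real.exp u / 2) ≤ c * θK * K :=
        mul_le_mul (mul_le_mul_of_nonneg_left hθu hc0.le) hK2 (by positivity) (by positivity)
      have h2 : c * u⁻¹ * (Real.exp u / 2) = 2 * (c * Real.exp u / (4 * u)) := by
        field_simp; ring
      linarith
    have hE0 : 0 ≤ E := by rw [hE]; exact (Real.exp_pos _).le
    have hkey := key_growth hc0 hc1 hD1 hu4 huD
    -- `exp(-8Du) ≤ 1/(8Du)`
    have h8Du : Real.exp (-(8 * D * u)) ≤ (8 * D * u)⁻¹ := by
      rw [Real.exp_neg]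
      apply inv_anti₀ (by positivity)
      linarith [Real.add_one_le_exp (8 * D * u)]
    have hE' : E ≤ (8 * D * u)⁻¹ := by
      refine hE_le.trans (le_trans (Real.exp_le_exp.2 ?_) h8Du)
      have : 0 ≤ (D + 3 * u) * Real.exp (u / 4) := by positivity
      linarith
    -- Term 1
    have hT1 : 8 / c ^ 2 * (C₀ / r * 360 * E * s) ≤ 1 / 16 := by
      have hEs : E * s ≤ (8 * D * u)⁻¹ := by
        calc E * s ≤ Real.exp (-(c * Real.exp u / (4 * u))) *
              Real.exp ((D + 3 * u) * Real.exp (u / 4)) :=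
              mul_le_mul hE_le hs_le hs0 (Real.exp_pos _).le
          _ = Real.exp (-(c * Real.exp u / (4 * u)) + (D + 3 * u) * Real.exp (u / 4)) := by
              rw [Real.exp_add]
          _ ≤ Real.exp (-(8 * D * u)) := Real.exp_le_exp.2 (by linarith)
          _ ≤ (8 * D * u)⁻¹ := h8Du
      have hcoef : 8 / c ^ 2 * (C₀ / r * 360) = D / 2 * u ^ p := by
        rw [hr', ha, hD]; field_simp; ring
      calc 8 / c ^ 2 * (C₀ / r * 360 * E * s) = (8 / c ^ 2 * (C₀ / r * 360)) * (E * s) := by ring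
        _ = D / 2 * u ^ p * (E * s) := by rw [hcoef]
        _ ≤ D / 2 * u * (8 * D * u)⁻¹ :=
            mul_le_mul (mul_le_mul_of_nonneg_left hupu (by positivity)) hEs
              (mul_nonneg hE0 hs0) (by positivity)
        _ = 1 / 16 := by field_simp; ring
    -- Term 2
    have hT2 : 8 / c ^ 2 * (180 * E) ≤ 1 / 32 := by
      have hcoef : 8 / c ^ 2 * 180 ≤ D := by
        rw [hD, div_mul_eq_mul_div, div_le_div_iff₀ hc2 hc3]
        have hc31 : c ^ 3 ≤ c ^ 2 := by
          rw [pow_succ]; exact mul_le_of_le_one_right hc2.le hc1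
        have h1 : (8 : ℝ) * 180 * c ^ 3 ≤ 1440 * c ^ 2 := by linarith
        have h2 : (1440 : ℝ) * c ^ 2 ≤ 57600 * C₀ * c ^ 2 := by
          apply mul_le_mul_of_nonneg_right _ hc2.le; linarith
        linarith
      calc 8 / c ^ 2 * (180 * E) = (8 / c ^ 2 * 180) * E := by ring
        _ ≤ D * (8 * D * u)⁻¹ := mul_le_mul hcoef hE' hE0 hD0.le
        _ = (8 * u)⁻¹ := by field_simp
        _ ≤ 1 / 32 := by
            rw [inv_eq_one_div, div_le_div_iff₀ (by positivity) (by norm_num)]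
            linarith
    calc 8 / c ^ 2 * (C₀ / r * 360 * E * s + 180 * E)
        = 8 / c ^ 2 * (C₀ / r * 360 * E * s) + 8 / c ^ 2 * (180 * E) := by ring
      _ ≤ 1 / 16 + 1 / 32 := add_le_add hT1 hT2
      _ ≤ 1 / 4 := by norm_num

end Literature.Analysis.Fourier.Prop31
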